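import Literature.MathematicalPhysics.QuantumLattice.XYOrder
import Literature.MathematicalPhysics.QuantumLattice.LiebMattisLadder
import Literature.MathematicalPhysics.QuantumLattice.InfiniteVolumeSpinEntriesProofs
import Literature.MathematicalPhysics.QuantumLattice.LiebMattisSectorPF
import HarnessLib

/-!
# Perron–Frobenius existence in the magnetisation sectors of the XY model (negative-lane helper for
crux `InsertionFieldDelocalisation`, stmt-AtomisticToContinuum-9673)

Supports (does not close) stmt-AtomisticToContinuum-9673, route `BECStronglyRayleigh`: it feeds the
tightness theorem `four_le_const` of `Tightness.lean`. It is also the EXISTENCE half of the route's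
support item `SectorGroundStatePerron` (stmt-AtomisticToContinuum-9677; uniqueness, which needs
connectivity of the token graph, is not proved here). Self-contained (Literature imports only).

* `xxzZero_apply` : the `Δ = 0` XXZ Hamiltonian has zero diagonal and equals the Heisenberg Hamiltonian
  off the diagonal; hence it is real symmetric (`xxzZero_isHermitian`), weight preserving
  (`xxzZero_apply_eq_zero_of_weight_ne`) and, for `J ≤ 0`, has nonpositive off-diagonal entries
  (`re_xxzZero_apply_nonpos`).
* `mulVec_eq_smul_of_energy_le_on` : variational principle on an invariant subspace.
* `exists_nonneg_sectorGroundState` : for `J ≤ 0` every nonempty weight sector of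
  `xxzHamiltonian 1 G J 0` contains a nonzero entrywise real-nonnegative `ψ` with `Hψ = E_min(sector)ψ`
  (real part of a sector eigenvector, then `|·|`, which does not raise the Rayleigh quotient);
  `exists_nonneg_sectorGroundState_xyTorus` : the same for `xyTorus d L 1`, sector `N - L^d/2`,
  `N ≤ L^d`, in the exact shape of `SectorGroundStatePerron`'s first four conjuncts.
* `card_torusSite`, `weight_ind` : `|(ℤ/Lℤ)^d| = L^d`; the weight of an occupation indicator.
-/

noncomputable section

namespace Summit.AtomisticToContinuum.BoseEinsteinCondensation.Theorems.InsertionFieldDelocalisation.Negative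

open scoped BigOperators ComplexOrder
open Literature.MathematicalPhysics.QuantumLattice Literature.Probability.LatticeModels Matrix Finset

/-! ### (b₀) Perron–Frobenius EXISTENCE in the magnetisation sectors of the XY model

Every nonempty sector of `xxzHamiltonian 1 G J 0`, `J ≤ 0` (in particular of `xyTorus d L 1`) contains
a nonzero, entrywise real-nonnegative vector `ψ` with `Hψ = E_min(sector)ψ` — the existence half of
the route's support item `SectorGroundStatePerron` (stmt-9677; uniqueness, which needs connectivity,
is not proved here). Proof: off the diagonal `H` is the Heisenberg ferromagnet (real symmetric,
weight preserving, nonpositive off-diagonal entries); a real sector eigenvector `s` at the sector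
energy exists (`sector_groundState` + real parts), `|s|` has no larger Rayleigh quotient
(`Σ H_ij |s_i||s_j| ≤ Σ H_ij s_i s_j`), and a minimiser of the Rayleigh quotient on the invariant
sector is an eigenvector (variational principle on a subspace). This makes §(b) unconditional. -/

section PerronExistence

variable {Λ : Type*} [Fintype Λ] [DecidableEq Λ]

/-- `|(ℤ/Lℤ)^d| = L^d`. [folklore] -/
theorem card_torusSite (d L : ℕ) [NeZero L] : Fintype.card (TorusSite d L) = L ^ d := by
  show Fintype.card (Fin d → ZMod L) = L ^ d
  rw [Fintype.card_fun, ZMod.card, Fintype.card_fin]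

omit [DecidableEq Λ] in
/-- The weight (number of down spins) of an occupation indicator: `Σ_x (1_S)_x = |Sᶜ|`. [folklore] -/
theorem weight_ind [DecidableEq Λ] (S : Finset Λ) :
    (∑ x : Λ, ((if x ∈ S then (0 : Fin 2) else 1 : Fin 2) : ℕ)) = Sᶜ.card := by
  have h : ∀ x : Λ, ((if x ∈ S then (0 : Fin 2) else 1 : Fin 2) : ℕ) = if x ∉ S then 1 else 0 := by
    intro x
    by_cases hx : x ∈ S <;> simp [hx]
  simp_rw [h, Finset.sum_boole]
  rw [show (Finset.univ.filter fun x => x ∉ S) = Sᶜ from by ext x; simp]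
  exact Nat.cast_id _


/-- **The `Δ = 0` XXZ Hamiltonian, entrywise**: its diagonal vanishes and off the diagonal it is the
Heisenberg Hamiltonian with the same coupling (the `SᶻSᶻ` bond is diagonal, and
`SˣSˣ + SʸSʸ = ½(S⁺S⁻ + S⁻S⁺)` has no diagonal). [folklore] -/
theorem xxzZero_apply (G : SimpleGraph Λ) [DecidableRel G.Adj] (J : ℝ) (σ τ : TensorIndex Λ 2) :
    xxzHamiltonian 1 G J 0 σ τ = if σ = τ then 0 else heisenbergHamiltonian 1 G J σ τ := by
  rw [xxzHamiltonian, LiebMattis.heisenbergHamiltonian_apply, Matrix.smul_apply, Matrix.sum_apply,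
    smul_eq_mul]
  split_ifs with hστ
  · subst hστ
    rw [Finset.sum_eq_zero, mul_zero]
    intro e he
    induction e using Sym2.ind with
    | h x y =>
      have hxy : x ≠ y := G.ne_of_adj (by simpa using he)
      simp only [Sym2.lift_mk]
      rw [Complex.ofReal_zero, zero_smul, add_zero, Matrix.add_apply, spinBond_apply_of_ne 1 0 hxy,
        spinBond_apply_of_ne 1 1 hxy, if_pos (fun _ _ _ => rfl), if_pos (fun _ _ _ => rfl), spinVec_zero,
        spinVec_one, spinX_mul_spinX_add_spinY_mul_spinY]
      have h1 : spinRaise 1 (σ x) (σ x) = 0 := by rw [spinRaise_apply, if_neg (by omega)]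
      have h2 : spinRaise 1 (σ y) (σ y) = 0 := by rw [spinRaise_apply, if_neg (by omega)]
      rw [h1, h2]
      ring
  · congr 1
    refine Finset.sum_congr rfl fun e he => ?_
    induction e using Sym2.ind with
    | h x y =>
      have hxy : x ≠ y := G.ne_of_adj (by simpa using he)
      simp only [Sym2.lift_mk, spinDotSym_mk]
      rw [Complex.ofReal_zero, zero_smul, add_zero, spinDot, Matrix.sum_apply, Fin.sum_univ_three,
        Matrix.add_apply]
      have h2 : spinBond 1 2 x y σ τ = 0 := by
        rw [spinBond_apply_of_ne 1 2 hxy]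
        split_ifs with hc
        · rw [spinVec_two]
          have hne : σ x ≠ τ x ∨ σ y ≠ τ y := by
            by_contra h
            push Not at h
            apply hστ
            funext z
            by_cases hzx : z = x
            · rw [hzx, h.1]
            by_cases hzy : z = y
            · rw [hzy, h.2]
            exact hc z hzx hzy
          rcases hne with h | h
          · have : SpinOperators.spinZ 1 (σ x) (τ x) = 0 := by
              by_contra h'
              exact h (spinZ_apply_ne_zero 1 h')
            rw [this, zero_mul]
          · have : SpinOperators.spinZ 1 (σ y) (τ y) = 0 := by
              by_contra h'
              exact h (spinZ_apply_ne_zero 1 h')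
            rw [this, mul_zero]
        · rfl
      rw [h2, add_zero]

/-- The `Δ = 0` XXZ Hamiltonian has real entries. [folklore] -/
theorem star_xxzZero_apply (G : SimpleGraph Λ) [DecidableRel G.Adj] (J : ℝ) (σ τ : TensorIndex Λ 2) :
    star (xxzHamiltonian 1 G J 0 σ τ) = xxzHamiltonian 1 G J 0 σ τ := by
  rw [xxzZero_apply]
  split_ifs
  · exact star_zero _
  · exact LiebMattis.star_heisenbergHamiltonian_apply 1 G J σ τ

/-- The `Δ = 0` XXZ Hamiltonian is a symmetric matrix. [folklore] -/
theorem xxzZero_apply_comm (G : SimpleGraph Λ) [DecidableRel G.Adj] (J : ℝ) (σ τ : TensorIndex Λ 2) :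
    xxzHamiltonian 1 G J 0 σ τ = xxzHamiltonian 1 G J 0 τ σ := by
  rw [xxzZero_apply, xxzZero_apply]
  by_cases h : σ = τ
  · subst h
    rfl
  · rw [if_neg h, if_neg (Ne.symm h), LiebMattis.heisenbergHamiltonian_apply_comm]

/-- The `Δ = 0` XXZ Hamiltonian is Hermitian (real symmetric). [folklore] -/
theorem xxzZero_isHermitian (G : SimpleGraph Λ) [DecidableRel G.Adj] (J : ℝ) :
    (xxzHamiltonian 1 G J 0).IsHermitian :=
  Matrix.IsHermitian.ext fun σ τ => by rw [xxzZero_apply_comm G J τ σ, star_xxzZero_apply]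

/-- **Ferromagnetic sign**: for `J ≤ 0` the off-diagonal entries of the `Δ = 0` XXZ Hamiltonian
are nonpositive reals (`= J ×` a nonnegative hop amplitude). [folklore] -/
theorem re_xxzZero_apply_nonpos (G : SimpleGraph Λ) [DecidableRel G.Adj] {J : ℝ} (hJ : J ≤ 0)
    {σ τ : TensorIndex Λ 2} (hστ : σ ≠ τ) : (xxzHamiltonian 1 G J 0 σ τ).re ≤ 0 := by
  rw [xxzZero_apply, if_neg hστ]
  obtain ⟨t, ht0, ht⟩ := LiebMattis.heisenbergHamiltonian_apply_eq_real 1 G 1 zero_le_one hστ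
  have hscale : heisenbergHamiltonian 1 G J σ τ = (J : ℂ) * heisenbergHamiltonian 1 G 1 σ τ := by
    rw [LiebMattis.heisenbergHamiltonian_apply, LiebMattis.heisenbergHamiltonian_apply]
    push_cast
    ring
  rw [hscale, ht, ← Complex.ofReal_mul, Complex.ofReal_re]
  exact mul_nonpos_of_nonpos_of_nonneg hJ ht0

/-- The `Δ = 0` XXZ Hamiltonian preserves the weight `Σ_x σ_x`. [folklore] -/
theorem xxzZero_apply_eq_zero_of_weight_ne (G : SimpleGraph Λ) [DecidableRel G.Adj] (J : ℝ)
    {σ τ : TensorIndex Λ 2} (hw : (∑ x, (σ x : ℕ)) ≠ ∑ x, (τ x : ℕ)) :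
    xxzHamiltonian 1 G J 0 σ τ = 0 := by
  rw [xxzZero_apply]
  split_ifs
  · rfl
  · exact LiebMattis.heisenbergHamiltonian_apply_eq_zero_of_weight_ne 1 G J hw

/-- **Variational principle on an invariant subspace.** If `A` is Hermitian, `K` an `A`-invariant
subspace, `E ‖v‖² ≤ Re ⟨v, Av⟩` on `K`, and `w ∈ K` attains the bound, then `A w = E w`. (Expand
`0 ≤ Re ⟨w + t z, (A - E)(w + t z)⟩` with `z = (A - E) w ∈ K`.) [folklore] -/
theorem mulVec_eq_smul_of_energy_le_on {ι : Type*} [Fintype ι] {A : Matrix ι ι ℂ}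
    (hA : Aᴴ = A) (K : Submodule ℂ (ι → ℂ)) (hK : ∀ v ∈ K, A *ᵥ v ∈ K) {E : ℝ}
    (hE : ∀ v ∈ K, E * (star v ⬝ᵥ v).re ≤ (star v ⬝ᵥ A *ᵥ v).re) {w : ι → ℂ} (hwK : w ∈ K)
    (hw : (star w ⬝ᵥ A *ᵥ w).re ≤ E * (star w ⬝ᵥ w).re) : A *ᵥ w = (E : ℂ) • w := by
  -- adapted from `Literature.MathematicalPhysics.QuantumLattice.mulVec_eq_smul_of_energy_le`
  set T : (ι → ℂ) → (ι → ℂ) := fun v => A *ᵥ v - (E : ℂ) • v with hT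
  have hTK : ∀ v ∈ K, T v ∈ K := fun v hv => K.sub_mem (hK v hv) (K.smul_mem _ hv)
  have hre : ∀ v v' : ι → ℂ, (star v ⬝ᵥ T v').re =
      (star v ⬝ᵥ A *ᵥ v').re - E * (star v ⬝ᵥ v').re := by
    intro v v'
    simp only [hT, dotProduct_sub, dotProduct_smul, smul_eq_mul, Complex.sub_re,
      Complex.re_ofReal_mul]
  have hTpos : ∀ v ∈ K, 0 ≤ (star v ⬝ᵥ T v).re := fun v hv => by rw [hre]; linarith [hE v hv]
  have hTw : (star w ⬝ᵥ T w).re ≤ 0 := by rw [hre]; linarith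
  have hAsa : ∀ v v' : ι → ℂ, star v ⬝ᵥ A *ᵥ v' = star (star v' ⬝ᵥ A *ᵥ v) := by
    intro v v'
    conv_rhs => rw [← star_dotProduct_star, star_star, star_mulVec, ← dotProduct_mulVec, hA]
  have hTsa : ∀ v v' : ι → ℂ, star v ⬝ᵥ T v' = star (star v' ⬝ᵥ T v) := by
    intro v v'
    simp only [hT, dotProduct_sub, dotProduct_smul, smul_eq_mul, star_sub, star_mul',
      Complex.star_def, Complex.conj_ofReal]
    rw [hAsa v v', star_dotProduct v v']
    rfl
  have hTadd : ∀ v v', T (v + v') = T v + T v' := by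
    intro v v'
    simp only [hT, mulVec_add, smul_add]
    abel
  have hTsmul : ∀ (c : ℂ) (v), T (c • v) = c • T v := by
    intro c v
    simp only [hT, mulVec_smul, smul_sub, smul_comm c (E : ℂ) v]
  set z := T w with hz
  have hzK : z ∈ K := hTK w hwK
  have hzz : (star z ⬝ᵥ z).im = 0 :=
    (Complex.nonneg_iff.1 (dotProduct_star_self_nonneg z)).2.symm
  have hwTz : (star w ⬝ᵥ T z).re = (star z ⬝ᵥ z).re := by
    rw [hTsa, Complex.star_def, Complex.conj_re]
  have hexp : ∀ t : ℝ, (star (w + (t : ℂ) • z) ⬝ᵥ T (w + (t : ℂ) • z)).re =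
      (star w ⬝ᵥ T w).re + 2 * t * (star z ⬝ᵥ z).re + t ^ 2 * (star z ⬝ᵥ T z).re := by
    intro t
    rw [hTadd, hTsmul, star_add, star_smul, add_dotProduct, dotProduct_add, dotProduct_add,
      smul_dotProduct, smul_dotProduct, dotProduct_smul, dotProduct_smul, ← hz]
    simp only [smul_eq_mul, Complex.star_def, Complex.conj_ofReal, Complex.add_re,
      Complex.re_ofReal_mul, hwTz]
    ring
  set q := (star z ⬝ᵥ z).re with hq
  set c := (star z ⬝ᵥ T z).re with hc
  have hc0 : 0 ≤ c := hTpos z hzK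
  have key := hTpos (w + ((-q / (c + 1) : ℝ) : ℂ) • z) (K.add_mem hwK (K.smul_mem _ hzK))
  rw [hexp] at key
  have hq0 : q = 0 := by
    have hc1 : (0 : ℝ) < c + 1 := by linarith
    have h1 : (star w ⬝ᵥ T w).re + 2 * (-q / (c + 1)) * q + (-q / (c + 1)) ^ 2 * c =
        (star w ⬝ᵥ T w).re - q ^ 2 * (c + 2) / (c + 1) ^ 2 := by
      field_simp
      ring
    rw [h1] at key
    have h3 : q ^ 2 * (c + 2) / (c + 1) ^ 2 ≤ 0 := by linarith
    rw [div_le_iff₀ (by positivity), zero_mul] at h3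
    nlinarith [sq_nonneg q]
  have hz0 : z = 0 := by
    have h : star z ⬝ᵥ z = 0 := Complex.ext (by simpa [hq] using hq0) (by simpa using hzz)
    exact dotProduct_star_self_eq_zero.1 h
  exact sub_eq_zero.1 hz0

/-- **Perron–Frobenius existence in a sector of the XY model.** For `J ≤ 0` and a nonempty weight
sector `W`, `xxzHamiltonian 1 G J 0` has a nonzero, entrywise real-nonnegative eigenvector in the
sector at the sector energy `E(M)`, `M = |Λ|/2 - W`. [folklore] -/
theorem exists_nonneg_sectorGroundState (G : SimpleGraph Λ) [DecidableRel G.Adj] {J : ℝ}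
    (hJ : J ≤ 0) (W : ℕ) (hW : ∃ σ : TensorIndex Λ 2, (∑ z, (σ z : ℕ)) = W) :
    ∃ ψ : TensorIndex Λ 2 → ℂ, ψ ≠ 0 ∧ (∀ σ, 0 ≤ (ψ σ).re ∧ (ψ σ).im = 0) ∧
      ψ ∈ spinZSector (Λ := Λ) 1 (((Fintype.card Λ * 1 : ℕ) : ℝ) / 2 - W) ∧
      xxzHamiltonian 1 G J 0 *ᵥ ψ =
        ((lowestEnergyInSector 1 (xxzHamiltonian 1 G J 0)
          (((Fintype.card Λ * 1 : ℕ) : ℝ) / 2 - W) : ℝ) : ℂ) • ψ := by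
  set H := xxzHamiltonian 1 G J 0 with hHdef
  set M : ℝ := ((Fintype.card Λ * 1 : ℕ) : ℝ) / 2 - W with hMdef
  set K := spinZSector (Λ := Λ) 1 M with hKdef
  have hK : ∀ v, v ∈ K ↔ ∀ σ, ¬(∑ z, (σ z : ℕ)) = W → v σ = 0 :=
    fun v => LiebMattis.mem_spinZSector_weight_iff 1 W v
  have hinv : ∀ σ τ : TensorIndex Λ 2, ¬(∑ z, (σ z : ℕ)) = W → (∑ z, (τ z : ℕ)) = W →
      H σ τ = 0 := fun σ τ hσ hτ =>
    xxzZero_apply_eq_zero_of_weight_ne G J (by rw [hτ]; exact hσ)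
  obtain ⟨⟨v, hvK, hv0, hHv⟩, hlow⟩ := sector_groundState H (xxzZero_isHermitian G J)
    (fun σ => (∑ z, (σ z : ℕ)) = W) hW hinv K hK
  set E : ℝ := H.minEnergyOn K with hEdef
  have hreal : ∀ i j, star (H i j) = H i j := star_xxzZero_apply G J
  -- a nonzero REAL eigenvector in the sector
  obtain ⟨s, hs0, hsK, hs⟩ : ∃ s : TensorIndex Λ 2 → ℝ, s ≠ 0 ∧
      (∀ σ, ¬(∑ z, (σ z : ℕ)) = W → s σ = 0) ∧
      (H *ᵥ fun j => ((s j : ℝ) : ℂ)) = (E : ℂ) • fun j => ((s j : ℝ) : ℂ) := by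
    by_cases hre : (fun j => (v j).re) = 0
    · refine ⟨fun j => (v j).im, ?_, ?_, PerronFrobenius.mulVec_im_eq_smul hreal hHv⟩
      · intro him
        apply hv0
        funext j
        exact Complex.ext (congrFun hre j) (congrFun him j)
      · intro σ hσ
        show (v σ).im = 0
        rw [(hK v).1 hvK σ hσ, Complex.zero_im]
    · refine ⟨fun j => (v j).re, hre, ?_, PerronFrobenius.mulVec_re_eq_smul hreal hHv⟩
      intro σ hσ
      show (v σ).re = 0
      rw [(hK v).1 hvK σ hσ, Complex.zero_re]
  -- its modulus
  set a : TensorIndex Λ 2 → ℝ := fun j => |s j| with hadef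
  have haK : (fun j => ((a j : ℝ) : ℂ)) ∈ K :=
    (hK _).2 fun σ hσ => by simp [hadef, hsK σ hσ]
  have hEa : (star (fun j => ((a j : ℝ) : ℂ)) ⬝ᵥ H *ᵥ fun j => ((a j : ℝ) : ℂ)).re ≤
      E * (star (fun j => ((a j : ℝ) : ℂ)) ⬝ᵥ fun j => ((a j : ℝ) : ℂ)).re := by
    rw [PerronFrobenius.re_star_dotProduct_mulVec_real, PerronFrobenius.re_star_dotProduct_self_real]
    have h1 : (star (fun j => ((s j : ℝ) : ℂ)) ⬝ᵥ H *ᵥ fun j => ((s j : ℝ) : ℂ)).re =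
        E * ∑ i, s i * s i := by
      rw [hs, dotProduct_smul, smul_eq_mul, Complex.re_ofReal_mul,
        PerronFrobenius.re_star_dotProduct_self_real]
    have hoff : ∀ i j, i ≠ j → (H i j).re ≤ 0 := fun i j hij => re_xxzZero_apply_nonpos G hJ hij
    calc ∑ i, ∑ j, (H i j).re * (|s i| * |s j|)
        ≤ ∑ i, ∑ j, (H i j).re * (s i * s j) := PerronFrobenius.sum_abs_mul_abs_le hoff s
      _ = E * ∑ i, s i * s i := by rw [← PerronFrobenius.re_star_dotProduct_mulVec_real, h1]
      _ = E * ∑ i, |s i| * |s i| := by simp only [abs_mul_abs_self]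
  have hEK : ∀ u ∈ K, E * (star u ⬝ᵥ u).re ≤ (star u ⬝ᵥ H *ᵥ u).re := fun u hu =>
    LiebMattis.mul_norm_le_of_unit_bound 1 H K hlow hu
  have hKinv : ∀ u ∈ K, H *ᵥ u ∈ K := by
    intro u hu
    rw [hK] at hu ⊢
    intro σ hσ
    rw [mulVec, dotProduct]
    refine Finset.sum_eq_zero fun τ _ => ?_
    by_cases hτ : (∑ z, (τ z : ℕ)) = W
    · rw [hinv σ τ hσ hτ, zero_mul]
    · rw [hu τ hτ, mul_zero]
  have hHa := mulVec_eq_smul_of_energy_le_on (xxzZero_isHermitian G J).eq K hKinv hEK haK hEa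
  refine ⟨fun j => ((a j : ℝ) : ℂ), ?_, ?_, haK, hHa⟩
  · obtain ⟨i, hi⟩ := Function.ne_iff.mp hs0
    refine Function.ne_iff.mpr ⟨i, ?_⟩
    show ((a i : ℝ) : ℂ) ≠ 0
    exact_mod_cast abs_ne_zero.mpr hi
  · intro σ
    simp [hadef, abs_nonneg]

/-- **Perron–Frobenius existence on the XY torus** (the existence half of `SectorGroundStatePerron`,
any dimension): for `N ≤ L^d` the sector `S³_tot = N - L^d/2` of `xyTorus d L 1` contains a nonzero
entrywise real-nonnegative vector `ψ` with `Hψ = E_min(sector)ψ`. [folklore] -/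
theorem exists_nonneg_sectorGroundState_xyTorus (d L : ℕ) [NeZero L] (N : ℕ) (hN : N ≤ L ^ d) :
    ∃ ψ : TensorIndex (TorusSite d L) 2 → ℂ, ψ ≠ 0 ∧ (∀ σ, 0 ≤ (ψ σ).re ∧ (ψ σ).im = 0) ∧
      ψ ∈ spinZSector 1 ((N : ℝ) - (L : ℝ) ^ d / 2) ∧
      (xyTorus d L 1).mulVec ψ =
        ((lowestEnergyInSector 1 (xyTorus d L 1) ((N : ℝ) - (L : ℝ) ^ d / 2) : ℝ) : ℂ) • ψ := by
  have hcard := card_torusSite d L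
  obtain ⟨S, -, hS⟩ : ∃ S ⊆ (Finset.univ : Finset (TorusSite d L)), S.card = N :=
    Finset.exists_subset_card_eq (by rw [Finset.card_univ, hcard]; exact hN)
  have hW : ∃ σ : TensorIndex (TorusSite d L) 2, (∑ z, (σ z : ℕ)) = L ^ d - N :=
    ⟨fun z => if z ∈ S then 0 else 1, by rw [weight_ind S, Finset.card_compl, hS, hcard]⟩
  have hM : (((Fintype.card (TorusSite d L) * 1 : ℕ) : ℝ) / 2 - ((L ^ d - N : ℕ) : ℝ)) =
      (N : ℝ) - (L : ℝ) ^ d / 2 := by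
    rw [hcard, Nat.cast_sub hN]
    push_cast
    ring
  have h := exists_nonneg_sectorGroundState (torusGraph d L) (show (-1 : ℝ) ≤ 0 by norm_num)
    (L ^ d - N) hW
  rw [hM] at h
  exact h

end PerronExistence


end Summit.AtomisticToContinuum.BoseEinsteinCondensation.Theorems.InsertionFieldDelocalisation.Negative
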